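import Mathlib
import Summits.ValiantsHypothesis.ValiantsHypothesis.Theorems.GrenetZeonDualUnipotentThreeHalvesSlowCoreLedger

/-!
# PART I (initial subspaces along a torus) — Theorems-side port of val-idea-28 g5's staged `…LongMassLedgerTorus.lean` (sha16 98392e2975984a00, 1360 l., 84 decls;
# itself the verbatim Part I/II-basics/III/IV/V/VI/VII extract of the crux workfile `Cruxes/DualUnipotentThreeHalves/InitialForm.lean` rev 14;
# crit-7 g3 V40 δ-READ ✓ of rev 13, STAGE REQUEST; desk val-lit RULINGS #389/#391/#392 «LedgerTorus claim protocol»; hand val-port-3 g3 «CLAIM LedgerTorus» 00:52Z)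

PORT NOTE.  Decl texts VERBATIM BY NAME; namespaces as staged (`…Theorems.GrenetZeon.InitialForm.*`); the ONLY changes are one-line docstrings on helper lemmas the gate's `lint.docstring` requires (marked «docstring added in the port»), the 400-line-cap SPLIT into five
chained modules `GrenetZeonDualUnipotentThreeHalvesLongMassLedgerTorus{Initial, Curve, SlowCurve, Slow, ∅}.lean` (this file imports ✓ `…SlowCoreLedger` + Mathlib) and these headers; `--supports stmt-ValiantsHypothesis-24318`
helper.  ALL CREDIT: val-idea-28 g5 (lens «degeneration – orbit-closure»).  HONEST STATUS (author's, verbatim in spirit): an INSTRUMENT — the normal form of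
(c)-certificates under a torus symmetry; proves NO case of (c) `SlowCore.LongMassSlowLawInv`, is NOT progress on (c); crux 24318 OPEN; VP ≠ VNP is NOT proved.
The author's full module docstring is reproduced in `GrenetZeonDualUnipotentThreeHalvesLongMassLedgerTorusInitial.lean`.
-/

/-! AUTHOR'S MODULE DOCSTRING (val-idea-28 g5, verbatim):
# Torus closure of `RelCert` certificates — `H_coord` in the currency of (c) `LongMassSlowLawInv` (instrument; by name)

Provenance: verbatim port of `Cruxes/DualUnipotentThreeHalves/InitialForm.lean` rev 14 (val-idea-28 g5, lens «degeneration – orbit-closure»; critic of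
record val-idea-crit-7 g3: V28/V29/V31/V33 ★★, V36 §B, V40), restricted to what the `RelCert`-currency results need.  HONEST STATUS: VP ≠ VNP is NOT
proved; crux 24318 `DualUnipotentThreeHalves` and the research law (c) `SlowCore.LongMassSlowLawInv` are OPEN; this file proves NO case of (c) and is
NOT progress on (c): it is an INSTRUMENT — the normal form of (c)-certificates under a torus symmetry — pressed `--supports stmt-ValiantsHypothesis-24318
--as helper`.

CONTENTS (by name vs ✓ `SlowCore.Ledger` / `SlowCore.RelCert` / `SlowCore.Slow`, all in ✓ `…SlowCoreDefs` / `…SlowCoreLedger`):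
* PART I (namespace `InitialForm`, generic index type `ι`, Mathlib only): the diagonal torus `torusAct w τ`, weight projections `wtProj`, the INITIAL
  SUBSPACE `initSub w K` of a subspace along the torus, `finrank_initSub` (same dimension, telescoping over weights), and the INITIAL-SUBSPACE THEOREM
  `exists_graded_of_torusStable`: from ONE subspace on which a torus-stable polynomial family vanishes, a WEIGHT-GRADED one of the same dimension.
* PART II (basics; namespace `InitialForm.TorusClosure`): `TorusEquivariant N w` (equivariance of an affine pencil under `λ_w` up to a nonzero scalar
  and a conjugation), `torusAct_zero`, `torusAct_inv_cancel`, `map_eval_map_C`.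
* PART III (namespace `InitialForm.CurveClosure`, Mathlib only): the `t`-adic initial subspace of an ALGEBRAIC family of subspaces —
  `exists_limit_of_algebraic_family` / `exists_limit_of_algebraic_family'` (canonical limit).
* PART IV (generic; namespace `InitialForm`): the MONOMIAL COUNT — with singleton weight classes a graded subspace is a coordinate subspace;
  `exists_wild_coordinate`.
* PART V (namespace `InitialForm.SlowCurve`): `Slow` is closed along polynomial curves for algebraic certificate families (power currency) —
  `curve`, `univCurve`, `slow_curve_zero_of_algebraic_family`.
* PART VI (namespace `InitialForm.SlowTorus`): `H_coord` in the power currency — `slowCone_torusAct`, `slow_graded_of_torusEquivariant`,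
  `not_slow_of_count`, `slow_iff_coordinate_span`.
* PART VII (namespace `InitialForm.LedgerTorus`): THE LEDGER / `RelCert` CURRENCY — `Gp`, `eval_Gp`, `WindowCone`, `ledger_top_iff_windowCone`,
  `windowCone_torusAct`, `windowFamily`, `windowCone_iff_family`, `ledger_graded_of_torusEquivariant`, ★ `relCert_iff_coordinate_span`,
  ★ `not_relCert_of_count`, `relCert_curve_zero_of_algebraic_family`.
Not ported here (left in the crux workfile / a later file): Part II's FLAG-currency closure (`wordCheap_graded_of_torusEquivariant`, …), Part IV's
`not_flagCheap_of_count`, Parts VIII–X (unipotent / Borel normal form, module-side closure).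
-/

set_option linter.dupNamespace false

namespace Summit.ValiantsHypothesis.ValiantsHypothesis.Theorems.GrenetZeon.InitialForm

open Polynomial

variable {ι : Type*}

/-- The diagonal one-parameter torus with weights `w`: `(λ_w(τ) v)_e = τ ^ (w e) * v e`. [folklore] -/
def torusAct (w : ι → ℕ) (τ : ℂ) (v : ι → ℂ) : ι → ℂ := fun e => τ ^ (w e) * v e

/-- Weight-`c` component of `v` (coordinates of weight `c` kept, the others zeroed). [folklore] -/
def wtProj (w : ι → ℕ) (c : ℕ) (v : ι → ℂ) : ι → ℂ := fun e => if w e = c then v e else 0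

/-- `v` is supported on coordinates of weight `≥ c`. -/
def SuppGe (w : ι → ℕ) (c : ℕ) (v : ι → ℂ) : Prop := ∀ e, w e < c → v e = 0

/-- `s` is an INITIAL FORM of `K` along `λ_w`: `s_e = (t_{w e})_e` for a family `t_c ∈ K` with `t_c` supported on weights `≥ c`
(i.e. `s = Σ_c π_c(t_c)`). [this file; = the `gr` of a subspace, WeightShadow §L1] -/
def IsInitialForm (w : ι → ℕ) (K : Submodule ℂ (ι → ℂ)) (s : ι → ℂ) : Prop :=
  ∃ t : ℕ → (ι → ℂ), (∀ c, t c ∈ K) ∧ (∀ c, SuppGe w c (t c)) ∧ ∀ e, s e = t (w e) e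

/-- The INITIAL SUBSPACE `in_λ(K)` of `K` along the torus `λ_w`. [this file] -/
def initSub (w : ι → ℕ) (K : Submodule ℂ (ι → ℂ)) : Submodule ℂ (ι → ℂ) where
  carrier := {s | IsInitialForm w K s}
  zero_mem' := ⟨fun _ => 0, fun _ => K.zero_mem, fun _ _ _ => rfl, fun _ => rfl⟩
  add_mem' := by
    rintro a b ⟨ta, hta, hsa, ha⟩ ⟨tb, htb, hsb, hb⟩
    refine ⟨fun c => ta c + tb c, fun c => K.add_mem (hta c) (htb c), fun c e he => ?_, fun e => ?_⟩
    · simp [Pi.add_apply, hsa c e he, hsb c e he]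
    · simp [Pi.add_apply, ha e, hb e]
  smul_mem' := by
    rintro r a ⟨ta, hta, hsa, ha⟩
    refine ⟨fun c => r • ta c, fun c => K.smul_mem r (hta c), fun c e he => ?_, fun e => ?_⟩
    · simp [Pi.smul_apply, hsa c e he]
    · simp [Pi.smul_apply, ha e]

/-- `mem_initSub` — helper of this port (see the module docstring for its role). (docstring added in the port) -/
theorem mem_initSub {w : ι → ℕ} {K : Submodule ℂ (ι → ℂ)} {s : ι → ℂ} :
    s ∈ initSub w K ↔ IsInitialForm w K s := Iff.rfl

/-- Elements of `K` supported on weights `≥ c` contribute their weight-`c` component. -/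
theorem wtProj_mem_initSub_of_mem {w : ι → ℕ} {K : Submodule ℂ (ι → ℂ)} {v : ι → ℂ} (hv : v ∈ K) {c : ℕ}
    (hs : SuppGe w c v) : wtProj w c v ∈ initSub w K := by
  refine ⟨fun c' => if c' = c then v else 0, fun c' => ?_, fun c' e he => ?_, fun e => ?_⟩
  · by_cases h : c' = c <;> simp [h, hv]
  · by_cases h : c' = c
    · subst h; simp [hs e he]
    · simp [h]
  · by_cases h : w e = c <;> simp [wtProj, h]

/-- A vector all of whose weight components lie in `K` is an initial form of `K` (so `initSub w K = K` for weight-graded `K`). -/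
theorem self_mem_initSub_of_graded {w : ι → ℕ} {K : Submodule ℂ (ι → ℂ)} {v : ι → ℂ}
    (hgr : ∀ c, wtProj w c v ∈ K) : v ∈ initSub w K := by
  refine ⟨fun c => wtProj w c v, hgr, fun c e he => ?_, fun e => ?_⟩
  · simp [wtProj, Nat.ne_of_lt he]
  · simp [wtProj]

/-- `initSub w K` is WEIGHT-GRADED: stable under every weight projection. -/
theorem wtProj_mem_initSub {w : ι → ℕ} {K : Submodule ℂ (ι → ℂ)} {s : ι → ℂ} (hs : s ∈ initSub w K) (c : ℕ) :
    wtProj w c s ∈ initSub w K := by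
  obtain ⟨t, ht, hsupp, hse⟩ := hs
  refine ⟨fun c' => if c' = c then t c else 0, fun c' => ?_, fun c' e he => ?_, fun e => ?_⟩
  · by_cases h : c' = c <;> simp [h, ht]
  · by_cases h : c' = c
    · subst h; simp [hsupp c' e he]
    · simp [h]
  · by_cases h : w e = c
    · simp [wtProj, h, hse e]
    · simp [wtProj, h]

/-- Evaluation of an `MvPolynomial` after substituting one-variable polynomials commutes with evaluating those polynomials. -/
theorem eval_aeval_polynomial (U : ι → Polynomial ℂ) (F : MvPolynomial ι ℂ) (τ : ℂ) :
    (MvPolynomial.aeval U F).eval τ = MvPolynomial.eval (fun e => (U e).eval τ) F := by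
  induction F using MvPolynomial.induction_on with
  | C a => simp
  | add p q hp hq => simp [map_add, Polynomial.eval_add, hp, hq]
  | mul_X p e hp => simp [map_mul, Polynomial.eval_mul, hp, MvPolynomial.aeval_X, MvPolynomial.eval_X]

/-- **INITIAL-FORM LEMMA (topology-free torus closure).**  If every `F ∈ 𝓕` vanishes on `λ_w(τ) • K` for every `τ ≠ 0`
(for a certificate condition this is the torus-EQUIVARIANCE of the pencil applied to ONE certificate `K`), then every
`F ∈ 𝓕` vanishes on the initial subspace `initSub w K`. [this file; MEMO-g5-closure-lever §5] -/
theorem eval_eq_zero_of_mem_initSub [Fintype ι] (w : ι → ℕ) (K : Submodule ℂ (ι → ℂ)) (𝓕 : Set (MvPolynomial ι ℂ))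
    (hK : ∀ τ : ℂ, τ ≠ 0 → ∀ v ∈ K, ∀ F ∈ 𝓕, MvPolynomial.eval (torusAct w τ v) F = 0)
    {s : ι → ℂ} (hs : s ∈ initSub w K) {F : MvPolynomial ι ℂ} (hF : F ∈ 𝓕) :
    MvPolynomial.eval s F = 0 := by
  obtain ⟨t, ht, hsupp, hse⟩ := hs
  -- all weights are `≤ D`
  set D : ℕ := Finset.univ.sup w with hD
  have hwD : ∀ e, w e ≤ D := fun e => Finset.le_sup (f := w) (Finset.mem_univ e)
  -- coordinates of `t c` vanish below weight `c`
  have htz : ∀ c e, w e < c → t c e = 0 := fun c e he => hsupp c e he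
  -- the curve `q(τ) = Σ_{c ≤ D} τ^{-c} • t_c` inside `K`
  let q : ℂ → (ι → ℂ) := fun τ => ∑ c ∈ Finset.range (D + 1), (τ⁻¹) ^ c • t c
  have hq : ∀ τ, q τ ∈ K := fun τ =>
    K.sum_mem fun c _ => K.smul_mem _ (ht c)
  -- the polynomial curve `U(τ) = λ_w(τ) q(τ)` (genuinely polynomial in `τ`), with `U(0) = s`
  let U : ι → Polynomial ℂ := fun e => ∑ c ∈ Finset.range (D + 1), Polynomial.C (t c e) * X ^ (w e - c)
  have hU_eval : ∀ τ e, (U e).eval τ = ∑ c ∈ Finset.range (D + 1), t c e * τ ^ (w e - c) := by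
    intro τ e
    simp [U, Polynomial.eval_finsetSum]
  have h1 : ∀ τ : ℂ, τ ≠ 0 → (fun e => (U e).eval τ) = torusAct w τ (q τ) := by
    intro τ hτ
    funext e
    rw [hU_eval]
    simp only [torusAct, q, Finset.sum_apply, Pi.smul_apply, smul_eq_mul, Finset.mul_sum]
    refine Finset.sum_congr rfl fun c _ => ?_
    by_cases hcw : c ≤ w e
    · have hsplit : τ ^ (w e) = τ ^ (w e - c) * τ ^ c := by
        rw [← pow_add, Nat.sub_add_cancel hcw]
      rw [hsplit]
      have hcc : τ ^ c * (τ⁻¹) ^ c = 1 := by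
        rw [← mul_pow, mul_inv_cancel₀ hτ, one_pow]
      calc t c e * τ ^ (w e - c) = τ ^ (w e - c) * (τ ^ c * (τ⁻¹) ^ c) * t c e := by rw [hcc]; ring
        _ = τ ^ (w e - c) * τ ^ c * ((τ⁻¹) ^ c * t c e) := by ring
    · have hz : t c e = 0 := htz c e (Nat.lt_of_not_le hcw)
      simp [hz]
  have h2 : (fun e => (U e).eval 0) = s := by
    funext e
    rw [hU_eval, hse e]
    rw [Finset.sum_eq_single (w e)]
    · simp
    · intro c _ hc
      rcases Nat.lt_or_gt_of_ne hc with hlt | hgt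
      · have hpos : w e - c ≠ 0 := Nat.sub_ne_zero_of_lt hlt
        simp [zero_pow hpos]
      · simp [htz c e hgt]
    · intro hnot
      exact absurd (Finset.mem_range.mpr (Nat.lt_succ_of_le (hwD e))) hnot
  -- `G(τ) := F(U(τ))` is a polynomial in `τ` vanishing on `ℂ ∖ {0}`
  let G : Polynomial ℂ := MvPolynomial.aeval U F
  have hG : ∀ τ, G.eval τ = MvPolynomial.eval (fun e => (U e).eval τ) F := fun τ =>
    eval_aeval_polynomial U F τ
  have hroot : ∀ τ : ℂ, τ ≠ 0 → G.IsRoot τ := by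
    intro τ hτ
    rw [Polynomial.IsRoot, hG, h1 τ hτ]
    exact hK τ hτ (q τ) (hq τ) F hF
  have hG0 : G = 0 := by
    refine Polynomial.eq_zero_of_infinite_isRoot G ?_
    refine Set.Infinite.mono (s := ({0}ᶜ : Set ℂ)) (fun τ hτ => hroot τ ?_) (Set.finite_singleton (0 : ℂ)).infinite_compl
    simpa [Set.mem_compl_iff, Set.mem_singleton_iff] using hτ
  -- hence at `τ = 0`
  have h0 : G.eval 0 = 0 := by rw [hG0, Polynomial.eval_zero]
  rw [hG, h2] at h0
  exact h0

/-- Packaging for certificate use: the initial subspace lies in the common zero locus of `𝓕`. -/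
theorem initSub_le_zeroLocus [Fintype ι] (w : ι → ℕ) (K : Submodule ℂ (ι → ℂ)) (𝓕 : Set (MvPolynomial ι ℂ))
    (hK : ∀ τ : ℂ, τ ≠ 0 → ∀ v ∈ K, ∀ F ∈ 𝓕, MvPolynomial.eval (torusAct w τ v) F = 0) :
    ∀ s ∈ initSub w K, ∀ F ∈ 𝓕, MvPolynomial.eval s F = 0 :=
  fun _ hs _ hF => eval_eq_zero_of_mem_initSub w K 𝓕 hK hs hF

/-! ## Dimension: `finrank (initSub w K) = finrank K` (telescoping ranks; self-contained, cf. `WeightShadow.finrank_gr_abstract`) -/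

/-- Coordinates of weight `≥ c`, as a submodule. -/
def Fge (w : ι → ℕ) (c : ℕ) : Submodule ℂ (ι → ℂ) where
  carrier := {v | SuppGe w c v}
  zero_mem' := fun _ _ => rfl
  add_mem' := by
    intro a b ha hb e he
    simp [Pi.add_apply, ha e he, hb e he]
  smul_mem' := by
    intro r a ha e he
    simp [Pi.smul_apply, ha e he]

/-- `mem_Fge` — helper of this port (see the module docstring for its role). (docstring added in the port) -/
theorem mem_Fge {w : ι → ℕ} {c : ℕ} {v : ι → ℂ} : v ∈ Fge w c ↔ SuppGe w c v := Iff.rfl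

/-- The weight projection as a linear map. -/
def wtProjₗ (w : ι → ℕ) (c : ℕ) : (ι → ℂ) →ₗ[ℂ] (ι → ℂ) where
  toFun := wtProj w c
  map_add' := by
    intro a b; funext e; by_cases h : w e = c <;> simp [wtProj, h]
  map_smul' := by
    intro r a; funext e; by_cases h : w e = c <;> simp [wtProj, h]

/-- `wtProjₗ_apply` — helper of this port (see the module docstring for its role). (docstring added in the port) -/
@[simp] theorem wtProjₗ_apply (w : ι → ℕ) (c : ℕ) (v : ι → ℂ) : wtProjₗ w c v = wtProj w c v := rfl

/-- `v` has weights `≥ c` and no weight-`c` component iff `v` has weights `≥ c+1`. -/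
theorem mem_Fge_succ_iff {w : ι → ℕ} {c : ℕ} {v : ι → ℂ} :
    v ∈ Fge w (c + 1) ↔ v ∈ Fge w c ∧ wtProj w c v = 0 := by
  constructor
  · intro hv
    refine ⟨fun e he => hv e (Nat.lt_succ_of_lt he), ?_⟩
    funext e
    by_cases h : w e = c
    · simp [wtProj, h, hv e (by omega)]
    · simp [wtProj, h]
  · rintro ⟨hv, hz⟩ e he
    rcases Nat.lt_succ_iff_lt_or_eq.mp he with hlt | heq
    · exact hv e hlt
    · have := congrFun hz e
      simpa [wtProj, heq] using this

/-- One telescoping step: `finrank π_c(L ∩ F_{≥c}) + finrank (L ∩ F_{≥c+1}) = finrank (L ∩ F_{≥c})` (rank–nullity). -/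
theorem finrank_step [Fintype ι] (w : ι → ℕ) (L : Submodule ℂ (ι → ℂ)) (c : ℕ) :
    Module.finrank ℂ ((L ⊓ Fge w c).map (wtProjₗ w c)) + Module.finrank ℂ (L ⊓ Fge w (c + 1) : Submodule ℂ (ι → ℂ)) =
      Module.finrank ℂ (L ⊓ Fge w c : Submodule ℂ (ι → ℂ)) := by
  set p : Submodule ℂ (ι → ℂ) := L ⊓ Fge w c with hp
  let φ : p →ₗ[ℂ] (ι → ℂ) := (wtProjₗ w c).domRestrict p
  have hrange : LinearMap.range φ = p.map (wtProjₗ w c) := by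
    ext y
    simp only [LinearMap.mem_range, Submodule.mem_map]
    constructor
    · rintro ⟨⟨x, hx⟩, rfl⟩
      exact ⟨x, hx, rfl⟩
    · rintro ⟨x, hx, rfl⟩
      exact ⟨⟨x, hx⟩, rfl⟩
  have hle : L ⊓ Fge w (c + 1) ≤ p := by
    intro v hv
    exact ⟨hv.1, (mem_Fge_succ_iff.mp hv.2).1⟩
  have hker : LinearMap.ker φ = Submodule.comap p.subtype (L ⊓ Fge w (c + 1)) := by
    ext ⟨v, hv⟩
    simp only [LinearMap.mem_ker, Submodule.mem_comap, Submodule.subtype_apply, Submodule.mem_inf]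
    change wtProjₗ w c v = 0 ↔ _
    rw [wtProjₗ_apply]
    have hv' : v ∈ L ∧ v ∈ Fge w c := hv
    constructor
    · intro hz
      exact ⟨hv'.1, mem_Fge_succ_iff.mpr ⟨hv'.2, hz⟩⟩
    · rintro ⟨-, h2⟩
      exact (mem_Fge_succ_iff.mp h2).2
  have hrn := LinearMap.finrank_range_add_finrank_ker φ
  rw [hrange, hker, (Submodule.comapSubtypeEquivOfLe hle).finrank_eq] at hrn
  exact hrn

/-- The graded pieces of `K` and of its initial subspace agree: `π_c(K ∩ F_{≥c}) = π_c(in_λ K ∩ F_{≥c})`. -/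
theorem map_inf_Fge_eq [Fintype ι] (w : ι → ℕ) (K : Submodule ℂ (ι → ℂ)) (c : ℕ) :
    (K ⊓ Fge w c).map (wtProjₗ w c) = (initSub w K ⊓ Fge w c).map (wtProjₗ w c) := by
  apply le_antisymm
  · rintro y ⟨t, ht, rfl⟩
    have ht' : t ∈ K ∧ t ∈ Fge w c := ht
    refine ⟨wtProj w c t, ⟨wtProj_mem_initSub_of_mem ht'.1 ht'.2, ?_⟩, ?_⟩
    · intro e he
      simp [wtProj, Nat.ne_of_lt he]
    · change wtProj w c (wtProj w c t) = wtProj w c t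
      funext e; by_cases h : w e = c <;> simp [wtProj, h]
  · rintro y ⟨s, hs, rfl⟩
    have hs' : s ∈ initSub w K ∧ s ∈ Fge w c := hs
    obtain ⟨t, ht, hsupp, hse⟩ := hs'.1
    refine ⟨t c, ⟨ht c, hsupp c⟩, ?_⟩
    change wtProj w c (t c) = wtProj w c s
    funext e
    by_cases h : w e = c
    · simp [wtProj, h, hse e]
    · simp [wtProj, h]

/-- Above the top weight the filtration is trivial. -/
theorem inf_Fge_eq_bot_of_lt [Fintype ι] (w : ι → ℕ) (L : Submodule ℂ (ι → ℂ)) {c : ℕ} (hc : ∀ e, w e < c) :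
    L ⊓ Fge w c = ⊥ := by
  rw [eq_bot_iff]
  intro v hv
  have hv' : v ∈ L ∧ v ∈ Fge w c := hv
  rw [Submodule.mem_bot]
  funext e
  exact hv'.2 e (hc e)

/-- At weight `0` the filtration is everything. -/
theorem inf_Fge_zero (w : ι → ℕ) (L : Submodule ℂ (ι → ℂ)) : L ⊓ Fge w 0 = L := by
  apply le_antisymm inf_le_left
  intro v hv
  exact ⟨hv, fun e he => absurd he (Nat.not_lt_zero _)⟩

/-- **DIMENSION OF THE INITIAL SUBSPACE**: `finrank (in_λ K) = finrank K`. [this file; telescoping over weights] -/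
theorem finrank_initSub [Fintype ι] (w : ι → ℕ) (K : Submodule ℂ (ι → ℂ)) :
    Module.finrank ℂ (initSub w K) = Module.finrank ℂ K := by
  set D : ℕ := Finset.univ.sup w with hD
  have hwD : ∀ e, w e ≤ D := fun e => Finset.le_sup (f := w) (Finset.mem_univ e)
  -- downward induction on the weight threshold
  have key : ∀ d, d ≤ D + 1 →
      Module.finrank ℂ (K ⊓ Fge w (D + 1 - d) : Submodule ℂ (ι → ℂ)) =
        Module.finrank ℂ (initSub w K ⊓ Fge w (D + 1 - d) : Submodule ℂ (ι → ℂ)) := by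
    intro d
    induction d with
    | zero =>
      intro _
      have hlt : ∀ e, w e < D + 1 - 0 := fun e => by
        rw [Nat.sub_zero]; exact Nat.lt_succ_of_le (hwD e)
      have h1 := inf_Fge_eq_bot_of_lt w K (c := D + 1 - 0) hlt
      have h2 := inf_Fge_eq_bot_of_lt w (initSub w K) (c := D + 1 - 0) hlt
      rw [h1, h2]
    | succ d ih =>
      intro hd
      have ih' := ih (Nat.le_of_succ_le hd)
      have hc : D + 1 - d = (D - d) + 1 := by omega
      have hc' : D + 1 - (d + 1) = D - d := by omega
      rw [hc] at ih'
      rw [hc']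
      have sK := finrank_step w K (D - d)
      have sH := finrank_step w (initSub w K) (D - d)
      rw [map_inf_Fge_eq w K (D - d)] at sK
      omega
  have h := key (D + 1) le_rfl
  rw [Nat.sub_self, inf_Fge_zero, inf_Fge_zero] at h
  exact h.symm

/-- **INITIAL-SUBSPACE THEOREM (H_coord for polynomial certificate families, topology-free).**  From ONE subspace `K` on which a
torus-stable polynomial family vanishes (`hK`), a WEIGHT-GRADED subspace of the SAME dimension on which it vanishes. -/
theorem exists_graded_of_torusStable [Fintype ι] (w : ι → ℕ) (K : Submodule ℂ (ι → ℂ)) (𝓕 : Set (MvPolynomial ι ℂ))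
    (hK : ∀ τ : ℂ, τ ≠ 0 → ∀ v ∈ K, ∀ F ∈ 𝓕, MvPolynomial.eval (torusAct w τ v) F = 0) :
    ∃ K₀ : Submodule ℂ (ι → ℂ), Module.finrank ℂ K₀ = Module.finrank ℂ K ∧
      (∀ s ∈ K₀, ∀ c, wtProj w c s ∈ K₀) ∧ (∀ s ∈ K₀, ∀ F ∈ 𝓕, MvPolynomial.eval s F = 0) :=
  ⟨initSub w K, finrank_initSub w K, fun _ hs c => wtProj_mem_initSub hs c,
    initSub_le_zeroLocus w K 𝓕 hK⟩

/-- Sanity: at `τ = 1` the hypothesis says `K` itself lies in the zero locus (`λ_w(1) = id`). -/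
theorem torusAct_one (w : ι → ℕ) (v : ι → ℂ) : torusAct w 1 v = v := by
  funext e; simp [torusAct]

end Summit.ValiantsHypothesis.ValiantsHypothesis.Theorems.GrenetZeon.InitialForm
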